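import Summits.BirchSwinnertonDyer.Rank1Residual.GaloisImage.KuriharaRecordBSDpThreeLevelOneEndOfBaseRigidity
import Literature.NumberTheory.GaloisCohomology.PoitouTateSelmerStructures
import HarnessLib

/-!
# R1-57-B, part 4: the END-m1 record corollaries with the Poitou–Tate family taken from the NAMED FACT
# `poitouTate_selmerStructure_duality ℚ` — the "WHAT A RECORD COSTS" form: named facts + port + row + values
# (cell `b2b-bsdres`, team n1011, ROUTE-1 §33.3 R1-57; row T-R1-57-B; seat p18)

HONEST FRAMING (cell `b2b-bsdres`, run/shared/lean/b2b/bsd-rank1-residual/, verbatim in every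
file): the goal of the cell is to DELETE the COMBINATION-SHAPED residual classes of the
Birch–Swinnerton-Dyer formula for ALL analytic-rank `≤ 1` elliptic curves over `ℚ` — "full BSD
formula for every rank `≤ 1` curve in class `C`" assembled STRICTLY from published theorems — so
that the rank-`≤ 1` remainder becomes exactly the CONSTRUCTION-SHAPED classes, which are TYPED
(missing-input `Prop`s), NOT attempted. This is not "finishing BSD". Team n1011 (N10/N11, the
additive block `X4 ∧ p = 3`): research route; PER-PAIR record shape, NOT a class theorem; TOOL
theorems only (no definition, no named fact minted); nothing booked; no mark / label moved.  END-m1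
= DEBT REDUCTION (BSD₃ only where `ord₃(L/Ω) ≤ 2`), not coverage.  CONDITIONAL on NAMED FACTS ONLY
(beyond the port and the evidence): the UPPER-half facts of the X4 chain of record (`hKatoS hDel
hmodD hKatoχ`; `hGZK hmod h26`), Cassels–Tate `hCT`, Poitou–Tate for Selmer structures `hPT`
(`poitouTate_selmerStructure_duality ℚ`: ONE family of local invariant maps with local Tate duality,
the reciprocity sum, unramified orthogonality and the Selmer complement — Milne ADT I 4.10 / Howard
2.1.11), Tate's `hEP`; the ONE port `KatoKuriharaPortThreeAt W 0 v₃` (FLAG `K22-Thm3.13-PORT@3`);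
NO [S24] fact (base rigidity, n1011-p11 R1-58 via n1011-p09).

## What and why

`KuriharaRecordBSDpThreeLevelOneEndOfBaseRigidity` (p292786) takes the Poitou–Tate family at `3` as
four binders `inv hperf hsum hcompl`.  The tree's named fact `poitouTate_selmerStructure_duality ℚ`
supplies such a family at every modulus (n1011-p13's `…OfFacts` pattern); this file is the twin with
those four binders replaced by the ONE fact `hPT`:

* `Assembly.bsdp_three_of_towerSurj_of_levelOneCertificates_of_facts` (potentially good, unit),
* `Assembly.bsdp_three_potMult_of_levelOneCertificates_of_facts` ((M) rows),

so that an END-m1 record reads: NAMED FACTS {hKatoS hDel hGZK hmod hmodD hKatoχ h26 hCT hPT hEP} +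
PORT {hPort} + ROW {hI hΔ hc₄, tower / surj + `ord₃ j < 0`, ht0, hr, htam / hc3, N ≤ 130000, D, hopt}
+ CERTIFICATE {n hn hcyc ψ hψ} + VALUES {hcert, hzero₁, ψ₂₇ hunit₁} — nothing else.

References: C.-H. Kim, AJM 148 (2026) Thm. 1.9 (6), Thm. 3.13 [Kim2022StructureSelmer]; K. Rubin,
PCMI 18 (2011) Thm. 2.8.4 [Rubin2011]; J. S. Milne, *Arithmetic Duality Theorems* (2006) I Thm. 4.10
[MilneADT2006]; B. Howard, Compositio 140 (2004) Thm. 2.1.11 [Howard2004HeegnerKolyvagin]; K. Kato,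
Astérisque 295 (2004) Thm. 14.5 (3) [Kato2004Asterisque]; A. Agashe, K. Ribet, W. Stein (2006)
Thm. 2.6 [AgasheRibetStein2006]; J. H. Silverman, AEC (2009) X.4.14 [SilvermanAEC2009].
-/

noncomputable section

open scoped Classical NumberField ContRepresentation
open Function Field NumberField IsDedekindDomain IsDedekindDomain.HeightOneSpectrum WeierstrassCurve
  CongruenceSubgroup
  Literature.NumberTheory.EllipticCurves Literature.NumberTheory.EllipticCurves.ModularForms
  Literature.NumberTheory.EllipticCurves.Rank1Residual
  Literature.NumberTheory.EllipticCurves.AgasheRibetStein2006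
  Literature.NumberTheory.GaloisRepresentations
  Literature.NumberTheory.GaloisRepresentations.DiscreteGaloisModule Literature.NumberTheory.GaloisCohomology
  Rat.HeightOneSpectrum
  Summit.BirchSwinnertonDyer.Rank1Residual.Additive Summit.BirchSwinnertonDyer.Rank1Residual.X4
open Literature.NumberTheory.DiophantineGeometry.Dioph (ratModP)

namespace Summit.BirchSwinnertonDyer.Rank1Residual.GaloisImage.Assembly

/-! ### The END-m1 record corollaries over the named Poitou–Tate fact -/

/-- **END-m1, RECORD COROLLARY (r1 ROUTE-1 §33.3): `BSD(E,3)` on a class-A1 row from ONE level-one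
Kurihara unit and two level-zero fields — NAMED-FACTS form** (`hPT` in place of the Poitou–Tate family):  `W/ℚ` globally minimal with
integral model `E₀` ADDITIVE at `3` (`3 ∣ Δ`, `3 ∣ c₄`), the `3`-adic tower (UPPER side),
`E(ℚ₃)[3] = 0`, analytic rank `0`, `3 ∤ ∏ c_ℓ`, an OPTIMAL datum at `N ≤ 130000`; the UPPER-half
facts of the X4 chain of record; NO [S24] fact of any level (injectivity at `∅` = n1011-p11's base
rigidity R1-58), NO `inv′` family; Cassels–Tate; the Poitou–Tate family at `3`
(`hperf hsum hcompl`), Tate's `hEP`; ONE port `KatoKuriharaPortThreeAt W 0 v₃`; and the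
CERTIFICATE: ONE `n ∈ 𝒩₁(E,3)` (any number of primes) with the cyclicity flag
`#(E₀ mod ℓ)(𝔽_ℓ)[3] ≤ 3` at its primes, surjective `ψ`, `δ̃_n(ψ) ≢ 0 (mod 3)`, and the two
level-zero fields `δ̃_1 ≡ 0 (mod 3)`, `δ̃_1 ≢ 0 (mod 27)`.  THEN `BSD(E, 3)`.  Binders = the pair
END `bsdp_three_of_towerSurj_of_pairCertificate`'s MINUS {hS24, hS24₂, inv′ ×4 (+ injectivity), hn2,
hNE, hε, hL20} PLUS {hCT, hzero₁, ψ₂₇ + hunit₁} — nothing else; −2 [S24] named facts per row.  (Lower half: p09's END-m1 ⟹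
`Sel₃ ≠ 0` ⟹ `9 ∣ #Ш(3)`; `27 ∤ [0]⁺` ⟹ `ord₃(L/Ω) ≤ 2 ≤ ord₃ #Ш(3)`; UPPER: additive-p4's socket.)
[cite: Kim2022StructureSelmer, Thm. 1.9 (6) and Thm. 3.13] [cite: Rubin2011, Thm. 2.8.4]
[cite: Kato2004Asterisque, Thm. 14.5 (3) (p. 236)] [cite: AgasheRibetStein2006, Thm. 2.6 (p. 619)]
[cite: SilvermanAEC2009, Thm. X.4.14] -/
theorem bsdp_three_of_towerSurj_of_levelOneCertificates_of_facts
    (hKatoS : Kato2004.rankZero_padicValNat_sha_le_sub_localTamagawa_of_additive_potGood_of_imageContainsSL2)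
    (hDel : Delbourgo1998.prop4_rankZero_pow_dvd_constantCoeff)
    (hGZK : rank_eq_analyticRank_of_analyticRank_le_one) (hmod : hasEntireLFunction_rat)
    (hmodD : nonempty_modularParametrizationData)
    (hKatoχ : Wuthrich2014.kato_halfEigenCharIdeal_dvd_cyclotomicPrime_of_surjective)
    (h26 : cremona_abs_maninConstant_eq_one_of_level_le)
    (hCT : exists_casselsTate_pairing (K := ℚ))
    (W : WeierstrassCurve ℚ) [W.IsElliptic] [W.IsGloballyMinimal]
    -- the row
    {E₀ : WeierstrassCurve ℤ} (hI : integralModelInt W = E₀)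
    (hΔ : (3 : ℤ) ∣ E₀.Δ) (hc₄ : (3 : ℤ) ∣ E₀.c₄)
    (htower : ∀ m : ℕ, W.HasSurjectiveModNGaloisRep (3 ^ m : ℕ))
    (ht0 : Nat.card {Q : (W.baseChange ℚ_[3]).toAffine.Point // (3 : ℕ) • Q = 0} = 1)
    (hr : W.analyticRank = 0) (htam : ¬ 3 ∣ W.tamagawaProduct)
    {N : ℕ} [NeZero N] (hN : N ≤ 130000) (D : ModularParametrizationData W N)
    (hopt : ∀ z ∈ D.L.lattice, ∃ w ∈ periodLattice D.f, z = D.c * w)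
    -- the Poitou–Tate family at `3`, Tate's local Euler characteristic, ONE port
    (hPT : poitouTate_selmerStructure_duality ℚ)
    (hEP : ∀ v : HeightOneSpectrum (𝓞 ℚ), localEulerPoincareCharacteristic (v.adicCompletion ℚ))
    (v₃ : HeightOneSpectrum (𝓞 ℚ)) (hv₃ : ((3 : ℕ) : 𝓞 ℚ) ∈ v₃.asIdeal)
    (hPort : KatoKuriharaPortThreeAt W 0 v₃)
    -- the certificate: ONE level-one unit, two level-zero fields
    (n : ℕ) [NeZero n] (hn : Kato.IsKolyvaginProduct W 3 1 n)
    (hcyc : ∀ (ℓ : ℕ) [Fact ℓ.Prime], ℓ ∣ n →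
      Nat.card {P : ((integralModelInt W).map (Int.castRingHom (ZMod ℓ))).toAffine.Point //
        3 • P = 0} ≤ 3)
    (ψ : (ℓ : ℕ) → (ZMod ℓ)ˣ →* Multiplicative (ZMod (3 ^ 1)))
    (hψ : ∀ ℓ ∈ n.primeFactors, Function.Surjective (ψ ℓ))
    (hcert : kuriharaNumber D.f (3 ^ 1) n ψ ≠ 0)
    (hzero₁ : kuriharaNumber D.f (3 ^ 1) 1 ψ = 0)
    (ψ₂₇ : (ℓ : ℕ) → (ZMod ℓ)ˣ →* Multiplicative (ZMod (3 ^ 3)))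
    (hunit₁ : kuriharaNumber D.f (3 ^ 3) 1 ψ₂₇ ≠ 0) :
    BSDp W 3 := by
  haveI : Fact (Nat.Prime 3) := ⟨Nat.prime_three⟩
  obtain ⟨inv, hperf, hsum, -, hcompl⟩ := hPT 3
  have hadd : Addv W 3 := addv_of_intModel hI 3 (by exact_mod_cast hΔ) (by exact_mod_cast hc₄)
  have hc3 : ¬ 3 ∣ (W.baseChange ℚ_[3]).localTamagawaNumber ℤ_[3] := fun h =>
    htam (h.trans (localTamagawaNumber_padic_dvd_tamagawaProduct W 3))
  have hsurj : W.HasSurjectiveModNGaloisRep ((3 : ℕ) : ℤ) := by simpa using htower 1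
  have hsurj' : W.HasSurjectiveModNGaloisRep 3 := by simpa using htower 1
  -- rank `0`: `E(ℚ)`, `Ш` finite; `E[3]` irreducible
  have hGZ := hGZK W (by rw [hr]; exact zero_le_one)
  haveI : Finite W.sha := hGZ.2
  haveI : Finite W.toAffine.Point := W.mordellWeilRank_eq_zero_iff_holds.mp (by rw [hGZ.1, hr])
  have hirr : W.HasIrreducibleModPGaloisRep 3 :=
    hasIrreducibleModPGaloisRep_of_hasSurjectiveModNGaloisRep W 3 hsurj'
  -- the optimal datum: `3 ∤ c_D`, the period transfer
  have hcD : ¬ (3 : ℤ) ∣ D.maninConstant :=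
    not_dvd_maninConstant_of_level_le h26 W D hopt hN Nat.prime_three
  have hper : ∃ u : ℚ, ‖(u : ℚ_[3])‖ = 1 ∧ W.realPeriodRat = u * plusPeriod D.f :=
    periodTransfer_of_optimal 3 D hopt hcD
  have hcP : ¬ ((3 : ℕ) : ℤ) ∣ D.maninConstant := by exact_mod_cast hcD
  -- LOWER: Sel₃ ≠ 0 (END-m1) ⟹ 9 ∣ #Ш(3); then the socket with the level-zero witness
  have hSel := exists_ne_zero_mem_selmerGroup_three_of_port_of_kolyvaginProduct_of_baseRigidity W hadd hc3
    hsurj ht0 D hcP hper inv hperf hsum hcompl hEP v₃ hv₃ hPort n hn hcyc ψ hψ hcert hzero₁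
  have h9 := sq_dvd_card_sha_three_of_exists_selmer_ne_zero hCT W hirr hSel
  exact bsdp_three_of_towerSurj_of_sq_dvd_card_sha hKatoS hDel hGZK hmod hmodD hKatoχ h26 W hI hΔ hc₄
    htower hr htam hN D hopt h9 ψ₂₇ hunit₁

/-- **END-m1, RECORD COROLLARY on the potentially MULTIPLICATIVE rows (`ord₃ j < 0`, class A1-(M)) —
NAMED-FACTS form.**  As `bsdp_three_of_towerSurj_of_levelOneCertificates_of_facts` with the UPPER
half through additive-p1's `ω`-branch socket: NO tower, NO Tamagawa hypothesis beyond `3 ∤ c₃`, NO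
Manin bound on the UPPER side (surj(3) and `ord₃ j < 0` instead); the LOWER side as there (the
optimal datum still feeds the period transfer of the `L`-value witness and the dictionary).
[cite: Kim2022StructureSelmer, Thm. 1.9 (6) and Thm. 3.13] [cite: Rubin2011, Thm. 2.8.4]
[cite: Delbourgo1998, Prop. 4 (p. 144)] [cite: AgasheRibetStein2006, Thm. 2.6 (p. 619)]
[cite: SilvermanAEC2009, Thm. X.4.14] -/
theorem bsdp_three_potMult_of_levelOneCertificates_of_facts
    (hKatoS : Kato2004.rankZero_padicValNat_sha_le_sub_localTamagawa_of_additive_potGood_of_imageContainsSL2)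
    (hDel : Delbourgo1998.prop4_rankZero_pow_dvd_constantCoeff)
    (hGZK : rank_eq_analyticRank_of_analyticRank_le_one) (hmod : hasEntireLFunction_rat)
    (hmodD : nonempty_modularParametrizationData)
    (hKatoχ : Wuthrich2014.kato_halfEigenCharIdeal_dvd_cyclotomicPrime_of_surjective)
    (h26 : cremona_abs_maninConstant_eq_one_of_level_le)
    (hCT : exists_casselsTate_pairing (K := ℚ))
    (W : WeierstrassCurve ℚ) [W.IsElliptic] [W.IsGloballyMinimal]
    {E₀ : WeierstrassCurve ℤ} (hI : integralModelInt W = E₀)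
    (hΔ : (3 : ℤ) ∣ E₀.Δ) (hc₄ : (3 : ℤ) ∣ E₀.c₄)
    (hsurj : W.HasSurjectiveModNGaloisRep ((3 : ℕ) : ℤ)) (hjneg : padicValRat 3 W.j < 0)
    (hc3 : ¬ 3 ∣ (W.baseChange ℚ_[3]).localTamagawaNumber ℤ_[3])
    (ht0 : Nat.card {Q : (W.baseChange ℚ_[3]).toAffine.Point // (3 : ℕ) • Q = 0} = 1)
    (hr : W.analyticRank = 0)
    {N : ℕ} [NeZero N] (hN : N ≤ 130000) (D : ModularParametrizationData W N)
    (hopt : ∀ z ∈ D.L.lattice, ∃ w ∈ periodLattice D.f, z = D.c * w)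
    (hPT : poitouTate_selmerStructure_duality ℚ)
    (hEP : ∀ v : HeightOneSpectrum (𝓞 ℚ), localEulerPoincareCharacteristic (v.adicCompletion ℚ))
    (v₃ : HeightOneSpectrum (𝓞 ℚ)) (hv₃ : ((3 : ℕ) : 𝓞 ℚ) ∈ v₃.asIdeal)
    (hPort : KatoKuriharaPortThreeAt W 0 v₃)
    (n : ℕ) [NeZero n] (hn : Kato.IsKolyvaginProduct W 3 1 n)
    (hcyc : ∀ (ℓ : ℕ) [Fact ℓ.Prime], ℓ ∣ n →
      Nat.card {P : ((integralModelInt W).map (Int.castRingHom (ZMod ℓ))).toAffine.Point //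
        3 • P = 0} ≤ 3)
    (ψ : (ℓ : ℕ) → (ZMod ℓ)ˣ →* Multiplicative (ZMod (3 ^ 1)))
    (hψ : ∀ ℓ ∈ n.primeFactors, Function.Surjective (ψ ℓ))
    (hcert : kuriharaNumber D.f (3 ^ 1) n ψ ≠ 0)
    (hzero₁ : kuriharaNumber D.f (3 ^ 1) 1 ψ = 0)
    (ψ₂₇ : (ℓ : ℕ) → (ZMod ℓ)ˣ →* Multiplicative (ZMod (3 ^ 3)))
    (hunit₁ : kuriharaNumber D.f (3 ^ 3) 1 ψ₂₇ ≠ 0) :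
    BSDp W 3 := by
  haveI : Fact (Nat.Prime 3) := ⟨Nat.prime_three⟩
  obtain ⟨inv, hperf, hsum, -, hcompl⟩ := hPT 3
  have hadd : Addv W 3 := addv_of_intModel hI 3 (by exact_mod_cast hΔ) (by exact_mod_cast hc₄)
  have hsurj' : W.HasSurjectiveModNGaloisRep 3 := by simpa using hsurj
  have hGZ := hGZK W (by rw [hr]; exact zero_le_one)
  haveI : Finite W.sha := hGZ.2
  haveI : Finite W.toAffine.Point := W.mordellWeilRank_eq_zero_iff_holds.mp (by rw [hGZ.1, hr])
  have hirr : W.HasIrreducibleModPGaloisRep 3 :=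
    hasIrreducibleModPGaloisRep_of_hasSurjectiveModNGaloisRep W 3 hsurj'
  have hcD : ¬ (3 : ℤ) ∣ D.maninConstant :=
    not_dvd_maninConstant_of_level_le h26 W D hopt hN Nat.prime_three
  have hper : ∃ u : ℚ, ‖(u : ℚ_[3])‖ = 1 ∧ W.realPeriodRat = u * plusPeriod D.f :=
    periodTransfer_of_optimal 3 D hopt hcD
  have hcP : ¬ ((3 : ℕ) : ℤ) ∣ D.maninConstant := by exact_mod_cast hcD
  have hSel := exists_ne_zero_mem_selmerGroup_three_of_port_of_kolyvaginProduct_of_baseRigidity W hadd hc3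
    hsurj ht0 D hcP hper inv hperf hsum hcompl hEP v₃ hv₃ hPort n hn hcyc ψ hψ hcert hzero₁
  have h9 := sq_dvd_card_sha_three_of_exists_selmer_ne_zero hCT W hirr hSel
  exact bsdp_three_potMult_of_sq_dvd_card_sha hKatoS hDel hGZK hmod hmodD hKatoχ h26 W hI hΔ hc₄ hsurj'
    hjneg hr hN D hopt h9 ψ₂₇ hunit₁

end Summit.BirchSwinnertonDyer.Rank1Residual.GaloisImage.Assembly

end
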